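import Summits.ValiantsHypothesis.ValiantsHypothesis.Theorems.BarrierLeverChowThinRowsLeaveTwoOut

/-!
# Route BarrierLever — item `ChowHitsThinRowPartitionMinorsR` (stmt-ValiantsHypothesis-21850, budget
# `h·h`): prelims for the labelled certificate (the squared truncated inverse)

Helper file (`--supports stmt-ValiantsHypothesis-21850`; cell valiant-natproofs, rung V4, 𝒟-side;
seat val-np-p5 gen 28).  Closes NO item; definition-free; imports only val-np-p7 g4's
`…ChowThinRowsLeaveTwoOut`.

* `form0_eq` — the `x`-free affine form in the two notations used by the cell;
* `coeff_tsq_top` — the top coefficient of the SQUARED truncated inverse `t_V · t_V` of the scaled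
  indicator form `1 + s·y_V` is `(-s)^{|V|} Σ_{X ⊆ V} |V∖X|!·|X|! ≠ 0` (`s ≠ 0`): the diagonal entry of
  a gadget row in the triangular factor of `…ChowHitsThinRowPartitionMinorsRLabels`.

WHAT THIS IS NOT: bookkeeping; nothing on items 21850 / 21882 / 19717 themselves, on crux
stmt-ValiantsHypothesis-14610, or on `VP` versus `VNP`.
-/

set_option linter.dupNamespace false

namespace Summit.ValiantsHypothesis.ValiantsHypothesis.Theorems.BarrierLever.ChowThinHH

open Finset MvPolynomial
open Summit.ValiantsHypothesis.ValiantsHypothesis.Theorems.BarrierLever.ChowFactor (coeff_partitionExpo_mul_yOnly)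
open Summit.ValiantsHypothesis.ValiantsHypothesis.Theorems.BarrierLever.ChowThinAll (coeff_tinvG yOnly_tinvG)

variable {h : ℕ}

/-! ## 1. Small tools -/

/-- The `x`-free form in the two notations. -/
theorem form0_eq (γV : Fin h → ℂ) (V : Finset (Fin h)) :
    (C 1 + ∑ a, C ((fun (_ : Fin h) (_ : Finset (Fin h)) => (0 : ℂ)) a V) * X (Fin.castAdd h a) +
        ∑ c, C (γV c) * X (Fin.natAdd h c) : MvPolynomial (Fin (h + h)) ℂ) =
      C 1 + ∑ c, C (γV c) * X (Fin.natAdd h c) := by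
  simp

/-- **Top coefficient of the squared truncated inverse** `t_V · t_V` for the scaled indicator
`γ V c = s · [c ∈ V]`: it is `(-s)^{|V|} · Σ_{X ⊆ V} |V ∖ X|! |X|! ≠ 0` for `s ≠ 0`. -/
theorem coeff_tsq_top (s : ℂ) (hs : s ≠ 0) (V : Finset (Fin h)) :
    coeff (∑ a ∈ (∅ : Finset (Fin h)), Finsupp.single (Fin.castAdd h a) 1 +
        ∑ c ∈ V, Finsupp.single (Fin.natAdd h c) 1)
        ((∑ U' ∈ V.powerset, monomial (∑ a ∈ (∅ : Finset (Fin h)), Finsupp.single (Fin.castAdd h a) 1 +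
            ∑ c ∈ U', Finsupp.single (Fin.natAdd h c) 1)
            ((-1 : ℂ) ^ U'.card * (U'.card.factorial : ℂ) *
              ∏ c ∈ U', (fun (V' : Finset (Fin h)) (c' : Fin h) => s * (if c' ∈ V' then (1 : ℂ) else 0)) V c)) *
          (∑ U' ∈ V.powerset, monomial (∑ a ∈ (∅ : Finset (Fin h)), Finsupp.single (Fin.castAdd h a) 1 +
            ∑ c ∈ U', Finsupp.single (Fin.natAdd h c) 1)
            ((-1 : ℂ) ^ U'.card * (U'.card.factorial : ℂ) *
              ∏ c ∈ U', (fun (V' : Finset (Fin h)) (c' : Fin h) => s * (if c' ∈ V' then (1 : ℂ) else 0)) V c))) ≠ 0 := by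
  classical
  set γ₂ : Finset (Fin h) → Fin h → ℂ := fun V' c' => s * (if c' ∈ V' then (1 : ℂ) else 0) with hγ₂
  have hprod : ∀ Y : Finset (Fin h), Y ⊆ V → ∏ c ∈ Y, γ₂ V c = s ^ Y.card := by
    intro Y hY
    rw [← Finset.prod_const]
    exact Finset.prod_congr rfl fun c hc => by simp only [hγ₂, if_pos (hY hc), mul_one]
  rw [coeff_partitionExpo_mul_yOnly _ _ (yOnly_tinvG γ₂ V) ∅ V]
  have hterm : ∀ X' ∈ V.powerset,
      coeff (∑ a ∈ (∅ : Finset (Fin h)), Finsupp.single (Fin.castAdd h a) 1 +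
          ∑ c ∈ V \ X', Finsupp.single (Fin.natAdd h c) 1)
          (∑ U' ∈ V.powerset, monomial (∑ a ∈ (∅ : Finset (Fin h)), Finsupp.single (Fin.castAdd h a) 1 +
            ∑ c ∈ U', Finsupp.single (Fin.natAdd h c) 1)
            ((-1 : ℂ) ^ U'.card * (U'.card.factorial : ℂ) * ∏ c ∈ U', γ₂ V c)) *
        coeff (∑ a ∈ (∅ : Finset (Fin h)), Finsupp.single (Fin.castAdd h a) 1 +
          ∑ c ∈ X', Finsupp.single (Fin.natAdd h c) 1)
          (∑ U' ∈ V.powerset, monomial (∑ a ∈ (∅ : Finset (Fin h)), Finsupp.single (Fin.castAdd h a) 1 +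
            ∑ c ∈ U', Finsupp.single (Fin.natAdd h c) 1)
            ((-1 : ℂ) ^ U'.card * (U'.card.factorial : ℂ) * ∏ c ∈ U', γ₂ V c)) =
        (-s) ^ V.card * (((V \ X').card.factorial * X'.card.factorial : ℕ) : ℂ) := by
    intro X' hX'
    have hX'V : X' ⊆ V := Finset.mem_powerset.mp hX'
    rw [coeff_tinvG, coeff_tinvG, if_pos Finset.sdiff_subset, if_pos hX'V, hprod _ Finset.sdiff_subset,
      hprod _ hX'V]
    have hcard : (V \ X').card + X'.card = V.card := Finset.card_sdiff_add_card_eq_card hX'V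
    rw [← hcard, Nat.cast_mul, neg_pow s, pow_add, pow_add]
    ring
  rw [Finset.sum_congr rfl hterm, ← Finset.mul_sum, ← Nat.cast_sum]
  refine mul_ne_zero (pow_ne_zero _ (neg_ne_zero.mpr hs)) ?_
  rw [Nat.cast_ne_zero]
  apply Nat.pos_iff_ne_zero.mp
  apply Finset.sum_pos
  · intro X' _
    exact Nat.mul_pos (Nat.factorial_pos _) (Nat.factorial_pos _)
  · exact ⟨∅, Finset.empty_mem_powerset _⟩


end Summit.ValiantsHypothesis.ValiantsHypothesis.Theorems.BarrierLever.ChowThinHH
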